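import Summits.QuantumFields.BalabanUV.Beta.GAN24.ScalarFreeResolventRows
import Summits.QuantumFields.BalabanUV.Beta.GAN24.QvOpSupLocality
import Summits.QuantumFields.BalabanUV.Beta.GAN24.Entry110GradCubic
import Literature.MathematicalPhysics.QuantumFieldTheory.Balaban1983to89.B5G115SupBound
import Summits.QuantumFields.BalabanUV.T4Continuum.Support.ScalarCovariantCTWeighted
import Literature.MathematicalPhysics.QuantumFieldTheory.Balaban1983to89.T4EtaRateOperatorTorus

/-!
# Row G-an2-4 ∕ (CONV-C), scalar currency — THE COMBES–THOMAS SITE WEIGHT `ρ_c = η·|· − c|_{T_η,∞}` ON BAŁABAN's FINE TORUS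
# (Lipschitz `1/n` along bonds, block oscillation `≤ 1`, `≤ 1` on the anchor's block, `≥ |y″ − y′|_{T₁,∞} − 1` on the block `y″`)
# and DECAY THROUGH A NONNEGATIVE KERNEL against pv15's `cosh` weight

NOT IN PRINT; OUR BOOKKEEPING.  Cell `pub-balaban`, G-an2-4 crux team (coordinator ruling e34b3e0c (2)), seat
`b2b-balaban-gan24-formalise-leaf-01` (gen 55), item «(L0) = (s0) = (K₀ˢ)» (requester `b2b-balaban-gan24-p2` gen 29, `HOME/INBOX.md` l.4418;
journal `CLAIMS.log` l.28990 ∕ l.29155), module 4 of the line towards the zeroth-order `n`-uniform block rows of NE2's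
`Gps n M a′ = (LapS + a′•PiS)⁻¹`.  The `ℓ²` Combes–Thomas bound of the tree (`CTScalarGreen.opNorm_conjMat_Gps_le`) takes ANY site weight
`ρ₀` that is `1/n`-Lipschitz along fine bonds and oscillates by `≤ Λ` on blocks; THIS FILE supplies the weight of the line — the scaled fine
torus sup-distance to an anchor site `c`, `ρ_c(z) = n⁻¹·|rep z − rep c|_{T_η,∞}` (written out, no `def`) — with its four geometric facts in
pv15's block currency (`bpt n M (toT M y) r`, `torusSupNorm`), and the one estimate that turns a nonnegative kernel with a `cosh`-weight row
bound into exponential decay between unit blocks.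

WHAT IS PROVED (kernel; any `d`, any `n ≥ 1`, any torus `M : Fin (d+1) → ℕ`):
 * §1 fine-torus distance bookkeeping: `tdist_comm`, `tdist_triangle`, `tdist_step_le` (a bond has length `≤ 1`), **`tdist_bpt_bpt`**
   (`|rep(n·y+r) − rep(n·y′+r′)|_{T_η} = |(n y + r) − (n y′ + r′)|_{T_η}`), `tdist_same_block_le` (`≤ n − 1`), `tdist_bpt_ge`
   (`≥ n|y − y′|_{T₁} − (n−1)`, pv15's `torusSupNorm_bpt_ge` BY NAME);
 * §2 the weight `ρ_c = n⁻¹·tdist(·, c)`: **`rho_lipschitz`** (`|ρ_c(z+e_ν) − ρ_c(z)| ≤ 1/n`), **`rho_osc`** (same block ⇒ `|ρ_c z − ρ_c z′| ≤ 1`),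
   **`rho_anchor_block_le`** (`ρ_c ≤ 1` on the block of `c = n·y′ + r₀`), **`rho_block_ge`** (`ρ_c(n·y″ + r″) ≥ |y″ − y′|_{T₁,∞} − 1`);
 * §4 `norm_mulVec_le_of_block_support` (`supp J ⊆ B(y′)`, `|J| ≤ B` ⟹ `‖(KJ)(x)‖ ≤ B·Σ_{r′}‖K(x, n·y′+r′)‖`, any `K`) and
   `nsq_wvec_le_of_block_support` (`nsq(e^{κρ}J) ≤ (e^κ)²·n^{d+1}·B²` when `ρ ≤ 1` on `B(y′)`);
 * §3 **`exp_coarse_le_weight`** (`e^{an|y − y″|_{T₁}} ≤ 2e^{a(n−1)}·W_x(n·y″+r″)` for pv15's `cosh`-weight `W_x` of slope `a` centred at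
   `x = n·y + r` — `weight_block_lower` BY NAME) and **`re_mulVec_blockDecay_le`**: for a kernel `K` with real nonnegative entries and
   `Re(K W_x)(x) ≤ A`: `Σ_z Re K(x,z)·e^{−an·|blk z − y′|_{T₁,∞}} ≤ 2A·e^{a(n−1)}·e^{−an|y − y′|_{T₁,∞}}`.

HONEST SCOPE.  [folklore] torus-distance bookkeeping for the cell's typed `U = 1` objects; nothing printed by Bałaban is used or asserted.
No `def`, no `def … : Prop`, no `sorry`.  NOT (CONV-C), NEVER «G-an2-4 closed», NOT NE2 ∕ NE3, NOT D1, NOT BetaPertH, NOT the continuum limit,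
NOT Clay.  HONEST DEPENDENCY: continuum YM on T⁴ ⇐ BetaPertH ∧ nine spine estimates (0/9 proved); BetaPertH ⇐ (D1) ∧ (D4) ∧ CAP+tail;
G-an2-4 gates asym, D1 and NE2/3/4.
-/

noncomputable section

open scoped BigOperators ComplexConjugate Matrix
open Finset Complex Matrix

namespace Summit.QuantumFields.BalabanUV.Beta.GAN24.ScalarSup110GWeight

open Literature.MathematicalPhysics.QuantumFieldTheory.Balaban1983to89
open B5Prop11Plancherel (Tor fine)
open B5Prop11Lower (nsq nsq_nonneg)
open B5Block118 (bpt)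
open B5Blocks16 (blockOf blockOf_bpt)
open B6LowerBound2153Torus (toT rep toT_rep toT_unitVec)
open B4TorusKernel.MultiPeriod (circAbs torusSupNorm torusSupNorm_nonneg torusSupNorm_le_supNorm)
open B4ContourShift (supNorm)
open B6Cov2156Torus (one_le_M)
open B5G183KernelDecay (bpt_toT)
open B5G183FreeUniform (torusSupNorm_bpt_ge)
open B5G183FreeRowSum (weight_block_lower)
open B5G115SupBound (exists_eq_bpt_blockOf)
open T4EtaRateOperatorTorus (torusSupNorm_neg)
open Summit.QuantumFields.BalabanUV.Beta.GAN24.QvOpSupLocality (torusSupNorm_congr_toT torusSupNorm_add_le' torusSupNorm_smul_unitVec_le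
  toT_sub')
open Summit.QuantumFields.BalabanUV.Beta.GAN24.Entry110GradCubic (torusSupNorm_rep_toT_sub_rep_toT)
open Summit.QuantumFields.BalabanUV.Beta.GAN24.ScalarFreeResolventRows (bpt_toT_injective)
open Summit.QuantumFields.BalabanUV.T4Continuum.ScalarCovariantCTWeighted (wvec)

variable {d : ℕ}

/-! ## §1 Fine-torus distance bookkeeping -/

section Dist

variable (N : Fin (d + 1) → ℕ) [hN : ∀ μ, NeZero (N μ)]

/-- symmetry of the site distance: `|rep a − rep b|_T = |rep b − rep a|_T` (`T4EtaRateOperatorTorus.torusSupNorm_neg` BY NAME). [folklore] -/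
theorem tdist_comm (a b : Tor N) : torusSupNorm N (rep N a - rep N b) = torusSupNorm N (rep N b - rep N a) := by
  rw [← torusSupNorm_neg N (rep N a - rep N b), neg_sub]

/-- triangle inequality of the site distance. [folklore] -/
theorem tdist_triangle (a b c : Tor N) :
    torusSupNorm N (rep N a - rep N c) ≤ torusSupNorm N (rep N a - rep N b) + torusSupNorm N (rep N b - rep N c) := by
  rw [show rep N a - rep N c = (rep N a - rep N b) + (rep N b - rep N c) by abel]
  exact torusSupNorm_add_le' N _ _

/-- a fine bond has length `≤ 1`: `|rep(z + e_ν) − rep z|_T ≤ 1` (any torus, also one-point directions). [folklore] -/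
theorem tdist_step_le (z : Tor N) (ν : Fin (d + 1)) :
    torusSupNorm N (rep N (z + B5Prop11Plancherel.unitVec N ν) - rep N z) ≤ 1 := by
  have h : toT N (rep N (z + B5Prop11Plancherel.unitVec N ν) - rep N z) = toT N ((1 : ℤ) • B6BondElimination.unitVec ν) := by
    rw [← toT_sub', toT_rep, toT_rep, one_smul, toT_unitVec, add_sub_cancel_left]
  rw [torusSupNorm_congr_toT N h]
  exact torusSupNorm_smul_unitVec_le N ν 1 (Or.inl rfl)

end Dist

section Blocks

variable (n : ℕ) [NeZero n] (M : Fin (d + 1) → ℕ) [hM : ∀ μ, NeZero (M μ)]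

/-- **block points**: `|rep(n·y + r) − rep(n·y′ + r′)|_{T_η} = |(n y + r) − (n y′ + r′)|_{T_η}` (the distance of the classes is that of
any integer representatives). [folklore] -/
theorem tdist_bpt_bpt (y y' : Fin (d + 1) → ℤ) (r r' : Fin (d + 1) → Fin n) :
    torusSupNorm (fine n M) (rep (fine n M) (bpt n M (toT M y) r) - rep (fine n M) (bpt n M (toT M y') r'))
      = torusSupNorm (fine n M) ((fun i => (n : ℤ) * y i + ((r i : ℕ) : ℤ)) - (fun i => (n : ℤ) * y' i + ((r' i : ℕ) : ℤ))) := by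
  rw [bpt_toT, bpt_toT]
  exact torusSupNorm_rep_toT_sub_rep_toT (fine n M) _ _

/-- two points of the same block are at fine distance `≤ n − 1`. [folklore] -/
theorem tdist_same_block_le (y : Fin (d + 1) → ℤ) (r r' : Fin (d + 1) → Fin n) :
    torusSupNorm (fine n M) (rep (fine n M) (bpt n M (toT M y) r) - rep (fine n M) (bpt n M (toT M y) r')) ≤ (n : ℝ) - 1 := by
  rw [tdist_bpt_bpt]
  refine (torusSupNorm_le_supNorm (one_le_M (fine n M)) _).trans ?_
  unfold supNorm
  refine Finset.sup'_le _ _ fun i _ => ?_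
  rw [Pi.sub_apply, show (n : ℤ) * y i + ((r i : ℕ) : ℤ) - ((n : ℤ) * y i + ((r' i : ℕ) : ℤ)) = ((r i : ℕ) : ℤ) - ((r' i : ℕ) : ℤ) by ring]
  have h := B5G183FreeUniform.abs_offset_sub_le n (r i) (r' i)
  have h3 := (Int.cast_le (R := ℝ)).mpr h
  push_cast at h3 ⊢
  exact h3

/-- two points of DIFFERENT blocks: `|rep(n·y + r) − rep(n·y′ + r′)|_{T_η} ≥ n·|y − y′|_{T₁} − (n − 1)` (pv15's `torusSupNorm_bpt_ge`).
[folklore] -/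
theorem tdist_bpt_ge (y y' : Fin (d + 1) → ℤ) (r r' : Fin (d + 1) → Fin n) :
    (n : ℝ) * torusSupNorm M (y - y') - ((n : ℝ) - 1)
      ≤ torusSupNorm (fine n M) (rep (fine n M) (bpt n M (toT M y) r) - rep (fine n M) (bpt n M (toT M y') r')) := by
  rw [tdist_bpt_bpt]
  exact torusSupNorm_bpt_ge n (Nat.one_le_iff_ne_zero.mpr (NeZero.ne n)) M y y' r r'

/-! ## §2 The Combes–Thomas weight `ρ_c(z) = n⁻¹·|rep z − rep c|_{T_η,∞}` -/

/-- **`ρ_c` is `1/n`-Lipschitz along fine bonds.** [folklore] -/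
theorem rho_lipschitz (c z : Tor (fine n M)) (ν : Fin (d + 1)) :
    |((n : ℝ))⁻¹ * torusSupNorm (fine n M) (rep (fine n M) (z + B5Prop11Plancherel.unitVec (fine n M) ν) - rep (fine n M) c)
      - ((n : ℝ))⁻¹ * torusSupNorm (fine n M) (rep (fine n M) z - rep (fine n M) c)| ≤ 1 / n := by
  have hn : (0 : ℝ) < n := by exact_mod_cast Nat.pos_of_ne_zero (NeZero.ne n)
  set z' := z + B5Prop11Plancherel.unitVec (fine n M) ν with hz'
  have h1 := tdist_triangle (fine n M) z' z c
  have h2 := tdist_triangle (fine n M) z z' c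
  have hs : torusSupNorm (fine n M) (rep (fine n M) z' - rep (fine n M) z) ≤ 1 := tdist_step_le (fine n M) z ν
  have hs' : torusSupNorm (fine n M) (rep (fine n M) z - rep (fine n M) z') ≤ 1 := by rw [tdist_comm]; exact hs
  rw [← mul_sub, abs_mul, abs_of_pos (inv_pos.mpr hn), one_div]
  refine mul_le_of_le_one_right (inv_nonneg.mpr hn.le) ?_
  rw [abs_le]
  constructor <;> linarith

/-- **`ρ_c` oscillates by `≤ 1` on every block** (`≤ (n−1)/n`). [folklore] -/
theorem rho_osc (c z z' : Tor (fine n M)) (h : blockOf n M z = blockOf n M z') :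
    |((n : ℝ))⁻¹ * torusSupNorm (fine n M) (rep (fine n M) z - rep (fine n M) c)
      - ((n : ℝ))⁻¹ * torusSupNorm (fine n M) (rep (fine n M) z' - rep (fine n M) c)| ≤ 1 := by
  have hn : (0 : ℝ) < n := by exact_mod_cast Nat.pos_of_ne_zero (NeZero.ne n)
  obtain ⟨r, hr⟩ := exists_eq_bpt_blockOf n M z
  obtain ⟨r', hr'⟩ := exists_eq_bpt_blockOf n M z'
  have hzz' : torusSupNorm (fine n M) (rep (fine n M) z - rep (fine n M) z') ≤ (n : ℝ) - 1 := by
    have e : z = bpt n M (toT M (rep M (blockOf n M z))) r := by rw [toT_rep]; exact hr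
    have e' : z' = bpt n M (toT M (rep M (blockOf n M z))) r' := by rw [toT_rep, h]; exact hr'
    rw [e, e']
    exact tdist_same_block_le n M _ r r'
  have h1 := tdist_triangle (fine n M) z z' c
  have h2 := tdist_triangle (fine n M) z' z c
  have hzz'' : torusSupNorm (fine n M) (rep (fine n M) z' - rep (fine n M) z) ≤ (n : ℝ) - 1 := by rw [tdist_comm]; exact hzz'
  rw [← mul_sub, abs_mul, abs_of_pos (inv_pos.mpr hn)]
  have h3 : |torusSupNorm (fine n M) (rep (fine n M) z - rep (fine n M) c) - torusSupNorm (fine n M) (rep (fine n M) z' - rep (fine n M) c)|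
      ≤ (n : ℝ) := by rw [abs_le]; constructor <;> linarith
  calc ((n : ℝ))⁻¹ * |torusSupNorm (fine n M) (rep (fine n M) z - rep (fine n M) c)
        - torusSupNorm (fine n M) (rep (fine n M) z' - rep (fine n M) c)| ≤ ((n : ℝ))⁻¹ * n :=
        mul_le_mul_of_nonneg_left h3 (inv_nonneg.mpr hn.le)
    _ = 1 := inv_mul_cancel₀ hn.ne'

/-- **on the anchor's block `ρ_c ≤ 1`**: for `c = n·y′ + r₀` and `z = n·y′ + r′`. [folklore] -/
theorem rho_anchor_block_le (y' : Fin (d + 1) → ℤ) (r₀ r' : Fin (d + 1) → Fin n) :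
    ((n : ℝ))⁻¹ * torusSupNorm (fine n M) (rep (fine n M) (bpt n M (toT M y') r') - rep (fine n M) (bpt n M (toT M y') r₀)) ≤ 1 := by
  have hn : (0 : ℝ) < n := by exact_mod_cast Nat.pos_of_ne_zero (NeZero.ne n)
  have h := tdist_same_block_le n M y' r' r₀
  calc ((n : ℝ))⁻¹ * torusSupNorm (fine n M) (rep (fine n M) (bpt n M (toT M y') r') - rep (fine n M) (bpt n M (toT M y') r₀))
      ≤ ((n : ℝ))⁻¹ * n := mul_le_mul_of_nonneg_left (by linarith) (inv_nonneg.mpr hn.le)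
    _ = 1 := inv_mul_cancel₀ hn.ne'

/-- **on the block `y″`, `ρ_c ≥ |y″ − y′|_{T₁,∞} − 1`** (`c = n·y′ + r₀`). [folklore] -/
theorem rho_block_ge (y' y'' : Fin (d + 1) → ℤ) (r₀ r'' : Fin (d + 1) → Fin n) :
    torusSupNorm M (y'' - y') - 1
      ≤ ((n : ℝ))⁻¹ * torusSupNorm (fine n M) (rep (fine n M) (bpt n M (toT M y'') r'') - rep (fine n M) (bpt n M (toT M y') r₀)) := by
  have hn : (0 : ℝ) < n := by exact_mod_cast Nat.pos_of_ne_zero (NeZero.ne n)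
  have hn1 : (1 : ℝ) ≤ n := by exact_mod_cast Nat.one_le_iff_ne_zero.mpr (NeZero.ne n)
  have h := tdist_bpt_ge n M y'' y' r'' r₀
  have hT := torusSupNorm_nonneg (one_le_M M) (y'' - y')
  rw [← div_eq_inv_mul, le_div_iff₀ hn]
  nlinarith

/-- `ρ_c ≤ 1` on the anchor's block, block-label form: `blockOf z = ȳ′` ⇒ `ρ_c z ≤ 1` (`c = n·y′ + r₀`). [folklore] -/
theorem rho_anchor_le (y' : Fin (d + 1) → ℤ) (r₀ : Fin (d + 1) → Fin n) (z : Tor (fine n M)) (hz : blockOf n M z = toT M y') :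
    ((n : ℝ))⁻¹ * torusSupNorm (fine n M) (rep (fine n M) z - rep (fine n M) (bpt n M (toT M y') r₀)) ≤ 1 := by
  obtain ⟨r', hr'⟩ := exists_eq_bpt_blockOf n M z
  rw [hz] at hr'
  rw [hr']
  exact rho_anchor_block_le n M y' r₀ r'

/-- `ρ_c ≥ |blk z − ȳ′|_{T₁,∞} − 1` everywhere, block-label form (`c = n·y′ + r₀`). [folklore] -/
theorem rho_ge (y' : Fin (d + 1) → ℤ) (r₀ : Fin (d + 1) → Fin n) (z : Tor (fine n M)) :
    torusSupNorm M (rep M (blockOf n M z) - rep M (toT M y')) - 1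
      ≤ ((n : ℝ))⁻¹ * torusSupNorm (fine n M) (rep (fine n M) z - rep (fine n M) (bpt n M (toT M y') r₀)) := by
  obtain ⟨r, hr⟩ := exists_eq_bpt_blockOf n M z
  set b := blockOf n M z with hb
  have h := rho_block_ge n M y' (rep M b) r₀ r
  rw [toT_rep, ← hr] at h
  have e : torusSupNorm M (rep M b - rep M (toT M y')) = torusSupNorm M (rep M b - y') :=
    torusSupNorm_congr_toT M (by rw [← toT_sub', ← toT_sub', toT_rep, toT_rep])
  rw [e]
  exact h

/-! ## §3 Exponential decay between unit blocks through a nonnegative kernel -/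

/-- **the coarse exponential against pv15's `cosh` weight**: for `x = n·y + r`, `z = n·y″ + r″` and slope `a ≥ 0`,
`e^{a·n·|y − y″|_{T₁,∞}} ≤ 2·e^{a(n−1)}·W_x(z)`, `W_x(z) = Π_μ cosh(a·dist(x_μ − z_μ))` (`weight_block_lower`). [folklore] -/
theorem exp_coarse_le_weight {a : ℝ} (ha : 0 ≤ a) (y y'' : Fin (d + 1) → ℤ) (r r'' : Fin (d + 1) → Fin n) :
    Real.exp (a * n * torusSupNorm M (y - y''))
      ≤ 2 * Real.exp (a * ((n : ℝ) - 1)) * ∏ μ, Real.cosh (a * (circAbs (fine n M μ)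
          ((bpt n M (toT M y) r μ - bpt n M (toT M y'') r'' μ : ZMod (fine n M μ)).val) : ℝ)) := by
  have hn1 : 1 ≤ n := Nat.one_le_iff_ne_zero.mpr (NeZero.ne n)
  have h := weight_block_lower n hn1 M ha y y'' r r''
  have e : Real.exp (a * n * torusSupNorm M (y - y''))
      = 2 * Real.exp (a * ((n : ℝ) - 1)) * (Real.exp (a * ((n : ℝ) * torusSupNorm M (y - y'') - ((n : ℝ) - 1))) / 2) := by
    rw [show a * ((n : ℝ) * torusSupNorm M (y - y'') - ((n : ℝ) - 1)) = a * n * torusSupNorm M (y - y'') - a * ((n : ℝ) - 1) by ring,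
      Real.exp_sub]
    field_simp
  rw [e]
  exact mul_le_mul_of_nonneg_left h (by positivity)

/-- **DECAY BETWEEN UNIT BLOCKS THROUGH A NONNEGATIVE KERNEL**: if `K` has real nonnegative entries and `Re (K W_x)(x) ≤ A` for pv15's
`cosh` weight of slope `a ≥ 0` centred at `x = n·y + r`, then
`Σ_z Re K(x,z)·e^{−a n·|blk z − y′|_{T₁,∞}} ≤ 2A·e^{a(n−1)}·e^{−a n·|y − y′|_{T₁,∞}}`
(`|y − y′| ≤ |y − blk z| + |blk z − y′|` and `e^{an|y − blk z|} ≤ 2e^{a(n−1)}W_x(z)`). [folklore] -/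
theorem re_mulVec_blockDecay_le (K : Matrix (Tor (fine n M)) (Tor (fine n M)) ℂ)
    (hK : ∀ x x', (K x x').im = 0 ∧ 0 ≤ (K x x').re) {a : ℝ} (ha : 0 ≤ a) {A : ℝ}
    (y y' : Fin (d + 1) → ℤ) (r : Fin (d + 1) → Fin n)
    (hA : ((K *ᵥ fun t => ((∏ μ', Real.cosh (a * (circAbs (fine n M μ')
        ((bpt n M (toT M y) r μ' - t μ' : ZMod (fine n M μ')).val) : ℝ)) : ℝ) : ℂ)) (bpt n M (toT M y) r)).re ≤ A) :
    ∑ z : Tor (fine n M), (K (bpt n M (toT M y) r) z).re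
        * Real.exp (-(a * n * torusSupNorm M (rep M (blockOf n M z) - rep M (toT M y'))))
      ≤ 2 * A * Real.exp (a * ((n : ℝ) - 1)) * Real.exp (-(a * n * torusSupNorm M (y - y'))) := by
  set x := bpt n M (toT M y) r with hx
  set W : Tor (fine n M) → ℝ := fun t =>
    ∏ μ', Real.cosh (a * (circAbs (fine n M μ') ((x μ' - t μ' : ZMod (fine n M μ')).val) : ℝ)) with hW
  have hW0 : ∀ t, 0 ≤ W t := fun t => Finset.prod_nonneg fun _ _ => (Real.cosh_pos _).le
  have han : 0 ≤ a * n := mul_nonneg ha (Nat.cast_nonneg n)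
  -- pointwise: `e^{−an|blk z − y′|} ≤ e^{−an|y − y′|}·2e^{a(n−1)}·W(z)`
  have hpt : ∀ z : Tor (fine n M), Real.exp (-(a * n * torusSupNorm M (rep M (blockOf n M z) - rep M (toT M y'))))
      ≤ Real.exp (-(a * n * torusSupNorm M (y - y'))) * (2 * Real.exp (a * ((n : ℝ) - 1)) * W z) := by
    intro z
    obtain ⟨r'', hr''⟩ := exists_eq_bpt_blockOf n M z
    set t := blockOf n M z with ht
    -- `|y − y′| ≤ |y − rep t| + |rep t − y′|`
    have htri : torusSupNorm M (y - y') ≤ torusSupNorm M (y - rep M t) + torusSupNorm M (rep M t - rep M (toT M y')) := by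
      have h1 := tdist_triangle M (toT M y) t (toT M y')
      rw [torusSupNorm_rep_toT_sub_rep_toT] at h1
      have h2 : torusSupNorm M (rep M (toT M y) - rep M t) = torusSupNorm M (y - rep M t) := by
        conv_lhs => rw [← toT_rep M t]
        exact torusSupNorm_rep_toT_sub_rep_toT M y (rep M t)
      rw [h2] at h1
      exact h1
    -- `e^{an|y − rep t|} ≤ 2e^{a(n−1)}W(z)`
    have hwt : Real.exp (a * n * torusSupNorm M (y - rep M t)) ≤ 2 * Real.exp (a * ((n : ℝ) - 1)) * W z := by
      have h := exp_coarse_le_weight n M ha y (rep M t) r r''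
      rw [toT_rep, ← hr''] at h
      exact h
    calc Real.exp (-(a * n * torusSupNorm M (rep M t - rep M (toT M y'))))
        ≤ Real.exp (-(a * n * torusSupNorm M (y - y'))) * Real.exp (a * n * torusSupNorm M (y - rep M t)) := by
          rw [← Real.exp_add, Real.exp_le_exp]
          nlinarith [mul_le_mul_of_nonneg_left htri han]
      _ ≤ Real.exp (-(a * n * torusSupNorm M (y - y'))) * (2 * Real.exp (a * ((n : ℝ) - 1)) * W z) :=
          mul_le_mul_of_nonneg_left hwt (Real.exp_pos _).le
  -- sum against the nonnegative kernel
  have hsum : ∑ z : Tor (fine n M), (K x z).re * W z = ((K *ᵥ fun t => (W t : ℂ)) x).re := by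
    simp only [Matrix.mulVec, dotProduct, Complex.re_sum, Complex.re_mul_ofReal]
  calc ∑ z : Tor (fine n M), (K x z).re * Real.exp (-(a * n * torusSupNorm M (rep M (blockOf n M z) - rep M (toT M y'))))
      ≤ ∑ z : Tor (fine n M), (K x z).re * (Real.exp (-(a * n * torusSupNorm M (y - y'))) * (2 * Real.exp (a * ((n : ℝ) - 1)) * W z)) :=
        Finset.sum_le_sum fun z _ => mul_le_mul_of_nonneg_left (hpt z) (hK x z).2
    _ = 2 * Real.exp (a * ((n : ℝ) - 1)) * Real.exp (-(a * n * torusSupNorm M (y - y'))) * ∑ z : Tor (fine n M), (K x z).re * W z := by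
        rw [Finset.mul_sum]
        exact Finset.sum_congr rfl fun z _ => by ring
    _ ≤ 2 * Real.exp (a * ((n : ℝ) - 1)) * Real.exp (-(a * n * torusSupNorm M (y - y'))) * A := by
        rw [hsum]
        exact mul_le_mul_of_nonneg_left hA (by positivity)
    _ = 2 * A * Real.exp (a * ((n : ℝ) - 1)) * Real.exp (-(a * n * torusSupNorm M (y - y'))) := by ring

/-! ## §4 Block-supported sources -/

/-- **block support ⇒ block row**: for `supp J ⊆ B(y′)`, `|J| ≤ B` and ANY matrix `K`, `‖(KJ)(x)‖ ≤ B·Σ_{r′}‖K(x, n·y′ + r′)‖`. [folklore] -/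
theorem norm_mulVec_le_of_block_support (K : Matrix (Tor (fine n M)) (Tor (fine n M)) ℂ) (y' : Fin (d + 1) → ℤ)
    (J : Tor (fine n M) → ℂ) {B : ℝ} (hJB : ∀ z, ‖J z‖ ≤ B)
    (hsupp : ∀ z, J z ≠ 0 → ∃ r' : Fin (d + 1) → Fin n, z = bpt n M (toT M y') r') (x : Tor (fine n M)) :
    ‖(K *ᵥ J) x‖ ≤ B * ∑ r' : Fin (d + 1) → Fin n, ‖K x (bpt n M (toT M y') r')‖ := by
  have hφ := bpt_toT_injective n M y'
  have hzero : ∀ z ∈ (Finset.univ : Finset (Tor (fine n M))),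
      z ∉ Finset.univ.image (fun r' : Fin (d + 1) → Fin n => bpt n M (toT M y') r') → K x z * J z = 0 := by
    intro z _ hz
    by_cases hJ : J z = 0
    · rw [hJ, mul_zero]
    · exfalso; apply hz
      obtain ⟨r', hr'⟩ := hsupp z hJ
      exact Finset.mem_image.mpr ⟨r', Finset.mem_univ _, hr'.symm⟩
  have hsum : (K *ᵥ J) x = ∑ r' : Fin (d + 1) → Fin n, K x (bpt n M (toT M y') r') * J (bpt n M (toT M y') r') := by
    simp only [Matrix.mulVec, dotProduct]
    rw [← Finset.sum_subset (Finset.subset_univ _) hzero, Finset.sum_image fun p _ q _ h => hφ h]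
  rw [hsum, Finset.mul_sum]
  refine (norm_sum_le _ _).trans (Finset.sum_le_sum fun r' _ => ?_)
  rw [norm_mul, mul_comm]
  exact mul_le_mul_of_nonneg_right (hJB _) (norm_nonneg _)

/-- **the weighted `ℓ²` norm of a block-supported source**: if the weight is `≤ 1` on `B(y′)` then
`nsq (e^{κρ}J) ≤ (e^κ)²·(n^{d+1}·B²)` (`|B(y′)| = n^{d+1}`). [folklore] -/
theorem nsq_wvec_le_of_block_support {κ : ℝ} (hκ : 0 ≤ κ) (ρ : Tor (fine n M) → ℝ) (y' : Fin (d + 1) → ℤ)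
    (hρ : ∀ r' : Fin (d + 1) → Fin n, ρ (bpt n M (toT M y') r') ≤ 1)
    (J : Tor (fine n M) → ℂ) {B : ℝ} (hJB : ∀ z, ‖J z‖ ≤ B)
    (hsupp : ∀ z, J z ≠ 0 → ∃ r' : Fin (d + 1) → Fin n, z = bpt n M (toT M y') r') :
    nsq (wvec κ ρ J) ≤ Real.exp κ ^ 2 * ((n : ℝ) ^ (d + 1) * B ^ 2) := by
  have hφ := bpt_toT_injective n M y'
  have hB0 : 0 ≤ B := (norm_nonneg _).trans (hJB (bpt n M (toT M y') fun _ => ⟨0, Nat.pos_of_ne_zero (NeZero.ne n)⟩))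
  have hzero : ∀ z ∈ (Finset.univ : Finset (Tor (fine n M))),
      z ∉ Finset.univ.image (fun r' : Fin (d + 1) → Fin n => bpt n M (toT M y') r') → ‖wvec κ ρ J z‖ ^ 2 = 0 := by
    intro z _ hz
    by_cases hJ : J z = 0
    · simp [wvec, hJ]
    · exfalso; apply hz
      obtain ⟨r', hr'⟩ := hsupp z hJ
      exact Finset.mem_image.mpr ⟨r', Finset.mem_univ _, hr'.symm⟩
  unfold nsq
  rw [← Finset.sum_subset (Finset.subset_univ _) hzero, Finset.sum_image fun p _ q _ h => hφ h]
  have hterm : ∀ r' : Fin (d + 1) → Fin n, ‖wvec κ ρ J (bpt n M (toT M y') r')‖ ^ 2 ≤ (Real.exp κ * B) ^ 2 := by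
    intro r'
    refine pow_le_pow_left₀ (norm_nonneg _) ?_ 2
    rw [wvec, norm_mul, Complex.norm_real, Real.norm_of_nonneg (Real.exp_pos _).le]
    exact mul_le_mul (Real.exp_le_exp.mpr (by nlinarith [hρ r'])) (hJB _) (norm_nonneg _) (Real.exp_pos _).le
  calc ∑ r' : Fin (d + 1) → Fin n, ‖wvec κ ρ J (bpt n M (toT M y') r')‖ ^ 2
      ≤ ∑ _r' : Fin (d + 1) → Fin n, (Real.exp κ * B) ^ 2 := Finset.sum_le_sum fun r' _ => hterm r'
    _ = Real.exp κ ^ 2 * ((n : ℝ) ^ (d + 1) * B ^ 2) := by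
        rw [Finset.sum_const, Finset.card_univ, Fintype.card_fun, Fintype.card_fin, Fintype.card_fin, nsmul_eq_mul]
        push_cast
        ring

end Blocks

end Summit.QuantumFields.BalabanUV.Beta.GAN24.ScalarSup110GWeight

end
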